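import Summits.QuantumFields.YangMills.Theorems.ParabolicTrajectoryContinuumLimitOnTrajectoryDefsB

/-!
# Route `ParabolicTrajectory`, crux `ContinuumLimitOnTrajectory` (stmt-QuantumFields-10522): vocabulary of line `jacobian-collapse-gronwall`

Route-posited objects (D-0016 `<Route><Crux>…Defs` file) of the SECOND line driven on this crux (lead seat
`prover-line-stmt-QuantumFields-10522-c1-0`; planner skeleton `Cruxes/ContinuumLimitOnTrajectory/Lines/jacobian_collapse_gronwall.lean`,
`planner-cruxplan-stmt-QuantumFields-10522-jacobian-collapse-gr-0`), VERBATIM the skeleton's declarations where unchanged (same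
namespace `…Cruxes.ContinuumLimitOnTrajectory.JacobianCollapseGronwall`, so the registered stub signatures
`stub_jacobianCollapse : JacobianCollapse`, `stub_levelSetTransport : LevelSetTransport` keep their meaning), RESHAPED by the lead onto
the landed vocabulary of line `two-orbit-synchronisation` (`…Defs`/`…DefsB`: `canon`, `curvNPoint`, `ConvProducts`, `UVB`,
`AsympEuclid`, `ARP`, `UCL`, `ND2`, `ND3`, `UVRegularity`, `ClusteringLeg`, and the landed packaging theorem `oneFieldOSLegs'`):
the planner's legs `InfraredBridge` (d3)/(d4), `APrioriBounds`, `Skewness`, `OSReconstruction` are replaced by those shared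
statements, and what is specific to this line is isolated in `JacobianCollapse` (engine), `LevelSetTransport` (pure analysis) and
`SmearedBridge` (§3, the jacobian-specific infrared/regularity inputs (d1)+(d2) of the old `InfraredBridge`).
NOTHING here is asserted: every `def … : Prop` is a line statement some registered stub proves or the composition consumes (none is a
literature fact, none restates the crux).
* §1 abstract calculus of level sets (pure real analysis; no lattice object): `jac`, `scalingWindow`, `CollapseOn`, `levelWindow`,
  the stub statement `LevelSetTransport` and the bookkeeping statement `CauchyBookkeeping` (PROVED in the companion glue file).
* §2 lattice vocabulary (transparent abbreviations over the tree's Wilson/torus declarations): `IsProfile`, `G2`, `timeSmeared`,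
  `plaqMean`, `curvMoment` (= `curvNPoint` of the canonical scheme at sequence points, proved in the glue file), `tensorOf`, `ObsIx`,
  `obsFun`.
* §3 the stub statements `JacobianCollapse` (verbatim) and `SmearedBridge` (new, minimal: exactly what the composition consumes).
* §4 registered glue (proved): `curvMoment_eq_curvNPoint`, `convProducts_of_cauchy` — the bridge to `curvNPoint`/`ConvProducts`.
Refs: line card `Lines/jacobian-collapse-gronwall.md`; Symanzik1983; LuscherWeiszWolff1991 (step scaling); Balaban1988Convergent Thm 1;
OsterwalderSeiler1978 §§2–3.
-/

set_option autoImplicit false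

open scoped SchwartzMap
open MeasureTheory Filter Topology
open Literature.MathematicalPhysics.QuantumFieldTheory Literature.MathematicalPhysics.QuantumLattice
open Literature.MathematicalPhysics.AQFT (IsOffDiagonal)
open Literature.Probability.LatticeModels (box)
open Summit.QuantumFields.YangMills.Theses.ParabolicTrajectory

noncomputable section

namespace Summit.QuantumFields.YangMills.Cruxes.ContinuumLimitOnTrajectory.JacobianCollapseGronwall

local notation "E⁴" => EuclideanSpace ℝ (Fin 4)

/-! ## §1 Abstract calculus of level sets (pure real analysis; no lattice object) -/

section Abstract

/-- The scale–coupling Jacobian `det ∂(X, N)/∂(log D, β)` of two observables `X, N : (D, β) ↦ ℝ`: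
`D ∂_D X · ∂_β N − D ∂_D N · ∂_β X` (one-variable `deriv`s of the slices). -/
def jac (X N : ℝ → ℝ → ℝ) (D β : ℝ) : ℝ :=
  D * deriv (fun D' => X D' β) D * deriv (N D) β - D * deriv (fun D' => N D' β) D * deriv (X D) β

/-- The two-observable SCALING WINDOW with coupling floor `B`: states `(D, β)` with `B ≤ β`, tuning observable
`N ∈ (θ₁, θ₂)` and brancher `R ∈ (ρ₁, ρ₂)`. -/
def scalingWindow (N R : ℝ → ℝ → ℝ) (B θ₁ θ₂ ρ₁ ρ₂ : ℝ) : Set (ℝ × ℝ) :=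
  {p | B ≤ p.2 ∧ N p.1 p.2 ∈ Set.Ioo θ₁ θ₂ ∧ R p.1 p.2 ∈ Set.Ioo ρ₁ ρ₂}

/-- **Collapse hypotheses** for one observable `X` against the tuning observable `N` on the window `W` over the
decade `D ∈ [D₁, D₂]`: `C²` regularity on `D > 0`; non-degenerate running `∂_β N ≠ 0`; ASCENT (constant physics
needs a non-decreasing coupling at finer cutoff: `dβ/dlog D = −D∂_D N/∂_β N ≥ 0`); bounded slope; the JACOBIAN
COLLAPSE `|jac X N| ≤ η |∂_β N|`; Lipschitz response `|∂_β X| ≤ Lip |∂_β N|` (all in ratio form). -/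
structure CollapseOn (X N : ℝ → ℝ → ℝ) (W : Set (ℝ × ℝ)) (D₁ D₂ η K Lip : ℝ) : Prop where
  smooth_N : ContDiffOn ℝ 2 (Function.uncurry N) (Set.Ioi (0 : ℝ) ×ˢ (Set.univ : Set ℝ))
  smooth_X : ContDiffOn ℝ 2 (Function.uncurry X) (Set.Ioi (0 : ℝ) ×ˢ (Set.univ : Set ℝ))
  deriv_ne : ∀ p ∈ W, p.1 ∈ Set.Icc D₁ D₂ → deriv (N p.1) p.2 ≠ 0
  ascend : ∀ p ∈ W, p.1 ∈ Set.Icc D₁ D₂ → p.1 * deriv (fun D => N D p.2) p.1 * deriv (N p.1) p.2 ≤ 0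
  slope_le : ∀ p ∈ W, p.1 ∈ Set.Icc D₁ D₂ →
    |p.1 * deriv (fun D => N D p.2) p.1| ≤ K * |deriv (N p.1) p.2|
  jac_le : ∀ p ∈ W, p.1 ∈ Set.Icc D₁ D₂ → |jac X N p.1 p.2| ≤ η * |deriv (N p.1) p.2|
  lip_le : ∀ p ∈ W, p.1 ∈ Set.Icc D₁ D₂ → |deriv (X p.1) p.2| ≤ Lip * |deriv (N p.1) p.2|

/-- The `β`-fibre of the scaling window at level `n`, volume `L` (multi-level bookkeeping form). -/
def levelWindow {ι : Type} (X : ι → ℕ → ℕ → ℝ → ℝ) (N : ℕ → ℕ → ℝ → ℝ) (i₀ : ι)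
    (B θ₁ θ₂ ρ₁ ρ₂ : ℝ) (n L : ℕ) : Set ℝ :=
  {b | B ≤ b ∧ N n L b ∈ Set.Ioo θ₁ θ₂ ∧ X i₀ n L b ∈ Set.Ioo ρ₁ ρ₂}

/-- **Stub statement B — level-set transport (Gronwall along the level sets of `N`).**  For a family of
observables `X i` and a tuning observable `N` satisfying `CollapseOn` on the two-observable window (brancher
`X i₀`) over `D ∈ [D₁, D₂]`: (a) every window state at `D₁` whose brancher is `η i₀ log(D₂/D₁)`-inside its
window is transported to `D₂` along the level set of `N` — the ODE `dβ/dlog D = −D∂_D N/∂_β N` (`C¹` vector field,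
`β` non-decreasing, slope `≤ K`, cannot leave the window) — with `N` preserved EXACTLY and every `X i` moved by at
most `η i · log(D₂/D₁)` (`|dX/dlog D| = |jac|/|∂_β N| ≤ η` along the curve); (b) on an order-connected `β`-fibre
two window states at the same scale differ in `X i` by at most `Lip i · |ΔN|` (`N` is strictly monotone there).
Pure real analysis over Mathlib. -/
def LevelSetTransport : Prop :=
  ∀ (ι : Type) (i₀ : ι) (X : ι → ℝ → ℝ → ℝ) (N : ℝ → ℝ → ℝ) (B θ₁ θ₂ ρ₁ ρ₂ D₁ D₂ K : ℝ)
    (η Lip : ι → ℝ), 0 < D₁ → D₁ ≤ D₂ → (∀ i, 0 ≤ η i) → (∀ i, 0 ≤ Lip i) →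
    (∀ i, CollapseOn (X i) N (scalingWindow N (X i₀) B θ₁ θ₂ ρ₁ ρ₂) D₁ D₂ (η i) K (Lip i)) →
    (∀ β₀ : ℝ, (D₁, β₀) ∈ scalingWindow N (X i₀) B θ₁ θ₂ ρ₁ ρ₂ →
        X i₀ D₁ β₀ ∈ Set.Ioo (ρ₁ + η i₀ * Real.log (D₂ / D₁)) (ρ₂ - η i₀ * Real.log (D₂ / D₁)) →
        ∃ β₁ : ℝ, β₀ ≤ β₁ ∧ N D₂ β₁ = N D₁ β₀ ∧
          ∀ i, |X i D₂ β₁ - X i D₁ β₀| ≤ η i * Real.log (D₂ / D₁)) ∧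
    (∀ D ∈ Set.Icc D₁ D₂, ({b : ℝ | (D, b) ∈ scalingWindow N (X i₀) B θ₁ θ₂ ρ₁ ρ₂}).OrdConnected →
        ∀ β β' : ℝ, (D, β) ∈ scalingWindow N (X i₀) B θ₁ θ₂ ρ₁ ρ₂ →
          (D, β') ∈ scalingWindow N (X i₀) B θ₁ θ₂ ρ₁ ρ₂ →
            ∀ i, |X i D β - X i D β'| ≤ Lip i * |N D β - N D β'|)

/-- **Bookkeeping statement C — Cauchy bookkeeping across scales** (the card's `CauchyAcrossScales`, generalised to
volumes and to the brancher; PROVED in the companion glue file).  Levels `n`, volumes `L`, couplings `β`; per-decade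
upward transport with summable defects `η i n · lM` on the level windows (brancher margin `η i₀ n · lM`), same-level
Lipschitz comparison, and a sequence `(n_k, L_k, β_k)` with `n_k → ∞`, admissible volumes, couplings above the floor,
`N → Θ` inside the window, brancher `→ Rinf` with a `4δ`-collar inside its window, and finite-size insensitivity AT the
sequence points.  Then every `X i` is Cauchy along the sequence. -/
def CauchyBookkeeping : Prop :=
  ∀ (ι : Type) (i₀ : ι) (X : ι → ℕ → ℕ → ℝ → ℝ) (N : ℕ → ℕ → ℝ → ℝ)
    (B θ₁ θ₂ ρ₁ ρ₂ lM : ℝ) (η : ι → ℕ → ℝ) (Lip : ι → ℝ) (vol : ℕ → ℕ) (n₀ : ℕ),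
    0 ≤ lM → Monotone vol → (∀ i n, 0 ≤ η i n) → (∀ i, Summable (η i)) → (∀ i, 0 ≤ Lip i) →
    (∀ n L, n₀ ≤ n → vol n ≤ L → ∀ β₀ ∈ levelWindow X N i₀ B θ₁ θ₂ ρ₁ ρ₂ n L,
        X i₀ n L β₀ ∈ Set.Ioo (ρ₁ + η i₀ n * lM) (ρ₂ - η i₀ n * lM) →
        ∃ β₁ : ℝ, β₀ ≤ β₁ ∧ N (n + 1) L β₁ = N n L β₀ ∧
          ∀ i, |X i (n + 1) L β₁ - X i n L β₀| ≤ η i n * lM) →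
    (∀ n L, n₀ ≤ n → vol n ≤ L → ∀ β ∈ levelWindow X N i₀ B θ₁ θ₂ ρ₁ ρ₂ n L,
        ∀ β' ∈ levelWindow X N i₀ B θ₁ θ₂ ρ₁ ρ₂ n L,
          ∀ i, |X i n L β - X i n L β'| ≤ Lip i * |N n L β - N n L β'|) →
    ∀ (nk Lk : ℕ → ℕ) (βk : ℕ → ℝ) (Θ Rinf δ : ℝ),
      Tendsto nk atTop atTop → (∀ᶠ k in atTop, vol (nk k) ≤ Lk k) → (∀ᶠ k in atTop, B ≤ βk k) →
      Tendsto (fun k => N (nk k) (Lk k) (βk k)) atTop (𝓝 Θ) → Θ ∈ Set.Ioo θ₁ θ₂ →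
      Tendsto (fun k => X i₀ (nk k) (Lk k) (βk k)) atTop (𝓝 Rinf) → 0 < δ →
      Set.Icc (Rinf - 4 * δ) (Rinf + 4 * δ) ⊆ Set.Ioo ρ₁ ρ₂ →
      (∀ ε > 0, ∀ᶠ k in atTop, ∀ S : ℕ, Lk k ≤ S →
          |N (nk k) S (βk k) - N (nk k) (Lk k) (βk k)| ≤ ε) →
      (∀ i, ∀ ε > 0, ∀ᶠ k in atTop, ∀ S : ℕ, Lk k ≤ S →
          |X i (nk k) S (βk k) - X i (nk k) (Lk k) (βk k)| ≤ ε) →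
      ∀ i, CauchySeq fun k => X i (nk k) (Lk k) (βk k)

end Abstract

/-! ## §2 Lattice vocabulary (transparent abbreviations over the tree's Wilson/torus declarations) -/

section Vocabulary

variable {G : Type} [Group G] [TopologicalSpace G] [IsTopologicalGroup G] [CompactSpace G]
  [MeasurableSpace G] [BorelSpace G]

/-- A **time profile**: `C²`, non-negative, supported in a compact sub-interval of `(1, ∞)` (strictly beyond
physical distance `1`), not zero. -/
structure IsProfile (φ : ℝ → ℝ) : Prop where
  smooth : ContDiff ℝ 2 φ
  nonneg : ∀ u, 0 ≤ φ u
  supported : ∃ a b : ℝ, 1 < a ∧ a ≤ b ∧ Function.support φ ⊆ Set.Icc a b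
  nontrivial : ∃ u, 0 < φ u

/-- The point-split connected curvature two-point function `⟨P ; τ_s P⟩_{β, 2L+1}` (time separation `s`, torus of
side `2L+1`; `P = r.curvature.F`, the Wilson action density). -/
def G2 (r : LatticeRep G) (β : ℝ) (L s : ℕ) : ℝ :=
  latticeConnectedCorr r.ρ β (2 * L + 1) r.curvature.F r.curvature.F s

/-- **The time-smeared dimensionless curvature two-point function at continuous scale `D`**:
`N^φ_L(D, β) = Σ_{s ≤ L} D⁷ φ(s/D) ⟨P ; τ_s P⟩_{β,2L+1}`, a Riemann sum of the crux's dimensionless data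
`a⁻⁸⟨P ; τ_{u/a} P⟩` against `φ(u) du` (`a = 1/D`).  Smooth in `D > 0` and `β`. -/
def timeSmeared (r : LatticeRep G) (φ : ℝ → ℝ) (L : ℕ) (D β : ℝ) : ℝ :=
  ∑ s ∈ Finset.range (L + 1), D ^ 7 * φ ((s : ℝ) / D) * G2 r β L s

/-- The plaquette (action-density) mean `⟨P⟩_{β, 2L+1}`: the additive renormalisation of the curvature field
(definitionally the tree's `wilsonTorusMean r.ρ β L r.curvature.F`). -/
def plaqMean (r : LatticeRep G) (β : ℝ) (L : ℕ) : ℝ :=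
  ∫ U, r.curvature.F (torusLift (2 * L + 1) U) ∂(wilsonMeasure (d := 4) (L := 2 * L + 1) r.ρ β)

/-- **Canonically renormalised, centred, smeared curvature `m`-point function** at spacing `a`, coupling `β`,
torus half-side `L`: `⟨∏ᵢ Φ_a(fᵢ)⟩` with `Φ_a(f) = a⁻⁴ · a⁴ Σ_x f(a x) (P(τₓU) − ⟨P⟩)` (`c = a⁻⁴`, `m = ⟨P⟩`; at the
points `(β, L, a) = (β_k, L_k, a_k)` of a scheme it IS `curvNPoint r sch k m f`, glue file). -/
def curvMoment (r : LatticeRep G) (β : ℝ) (L : ℕ) (a : ℝ) (m : ℕ) (f : Fin m → 𝓢(E⁴, ℝ)) : ℝ :=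
  ∫ U, ∏ i, smearedLatticeField r.curvature.F (box 4 L) a (a⁻¹ ^ 4) (plaqMean r β L) (f i)
      (torusLift (2 * L + 1) U) ∂(wilsonMeasure (d := 4) (L := 2 * L + 1) r.ρ β)

/-- The product tensor `f₁ ⊗ ⋯ ⊗ f_m` of real one-point test functions, as a complex `m`-point test function
(literally the tensor appearing in `ConvProducts`). -/
def tensorOf {m : ℕ} (f : Fin m → 𝓢(E⁴, ℝ)) : 𝓢((Fin m → E⁴), ℂ) :=
  SchwartzMap.tensorFin m fun i => ofRealTest (f i)

/-- **Index of transported observables**: the brancher (the time-smeared two-point function of the HALVED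
profile `φ(·/2)`, probing twice the physical distance), or an off-diagonal `m`-point test family. -/
inductive ObsIx : Type
  | brancher : ObsIx
  | moment (m : ℕ) (f : Fin m → 𝓢(E⁴, ℝ)) (hf : IsOffDiagonal (tensorOf f)) : ObsIx

/-- The observables as functions of `(D, β)` at fixed `(r, φ, L)`: brancher `N^{φ(·/2)}_L(D, β)`
(`= 2⁻⁷ N^φ_L(2D, β)`), moment `curvMoment r β L D⁻¹ m f` (spacing `a = 1/D`). -/
def obsFun (r : LatticeRep G) (φ : ℝ → ℝ) (L : ℕ) : ObsIx → ℝ → ℝ → ℝ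
  | ObsIx.brancher => fun D β => timeSmeared r (fun u => φ (u / 2)) L D β
  | ObsIx.moment m f _ => fun D β => curvMoment r β L D⁻¹ m f

/-- The brancher component of `obsFun`, by `rfl`. -/
theorem obsFun_brancher (r : LatticeRep G) (φ : ℝ → ℝ) (L : ℕ) :
    obsFun r φ L ObsIx.brancher = fun D β => timeSmeared r (fun u => φ (u / 2)) L D β := rfl

/-- The moment components of `obsFun`, by `rfl`. -/
theorem obsFun_moment (r : LatticeRep G) (φ : ℝ → ℝ) (L : ℕ) {m : ℕ} (f : Fin m → 𝓢(E⁴, ℝ))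
    (hf : IsOffDiagonal (tensorOf f)) :
    obsFun r φ L (ObsIx.moment m f hf) = fun D β => curvMoment r β L D⁻¹ m f := rfl

end Vocabulary

/-! ## §3 The line-specific stub STATEMENTS -/

/-- **Stub statement A — JACOBIAN COLLAPSE in the scaling region (load-bearing, hardest; verbatim the planner's).**
For compact simple `G`, `r`, and a time profile `φ`: `∃ M₀ ∀ M ≥ M₀ ∃ θ₀ σ B n₀ ℓ` such that in the scaling region
(`n ≥ n₀`, `L ≥ ℓMⁿ⁺¹`, `D ∈ [Mⁿ, Mⁿ⁺¹]`, `β ≥ B`): (i) RATIO GAP — whenever `N^φ ∈ (0, θ₀)` the brancher ratio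
`N^{φ(·/2)}/N^φ` is `≤ σ/2` (IR branch) or `≥ 4σ` (UV branch); (ii) for every branch-pure two-observable window
`0 < θ₁ < θ₂ < θ₀`, `0 < ρ₁ < ρ₂` (`2σθ₂ ≤ ρ₁` or `ρ₂ ≤ σθ₁`) there are summable `η i`, slopes `K n`, responses `Lip i`
with `CollapseOn` for EVERY observable (brancher and every off-diagonal centred curvature moment, `c = a⁻⁴`) against
`N^φ`, and order-connected `β`-fibres.  Physics: Symanzik/Callan–Symanzik universality as a single-theory
differential inequality with SUMMABLE remainder.  OPEN (XL). -/
def JacobianCollapse : Prop :=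
  ∀ (G : Type) [Group G] [TopologicalSpace G] [IsTopologicalGroup G] [CompactSpace G],
    IsCompactSimpleLieGroup G →
      letI : MeasurableSpace G := borel G
      haveI : BorelSpace G := ⟨rfl⟩
      ∀ (r : LatticeRep G) (φ : ℝ → ℝ), IsProfile φ →
        ∃ M₀ : ℕ, ∀ M : ℕ, M₀ ≤ M → 2 ≤ M →
          ∃ (θ₀ σ B : ℝ) (n₀ ℓ : ℕ), 0 < θ₀ ∧ 0 < σ ∧
            (∀ (n L : ℕ), n₀ ≤ n → ℓ * M ^ (n + 1) ≤ L →
              ∀ (D β : ℝ), D ∈ Set.Icc ((M : ℝ) ^ n) ((M : ℝ) ^ (n + 1)) → B ≤ β →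
                timeSmeared r φ L D β ∈ Set.Ioo 0 θ₀ →
                  obsFun r φ L ObsIx.brancher D β ≤ σ / 2 * timeSmeared r φ L D β ∨
                    4 * σ * timeSmeared r φ L D β ≤ obsFun r φ L ObsIx.brancher D β) ∧
            (∀ θ₁ θ₂ ρ₁ ρ₂ : ℝ, 0 < θ₁ → θ₁ < θ₂ → θ₂ < θ₀ → 0 < ρ₁ → ρ₁ < ρ₂ →
              (2 * σ * θ₂ ≤ ρ₁ ∨ ρ₂ ≤ σ * θ₁) →
              ∃ (η : ObsIx → ℕ → ℝ) (K : ℕ → ℝ) (Lip : ObsIx → ℝ),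
                (∀ i n, 0 ≤ η i n) ∧ (∀ i, Summable (η i)) ∧ (∀ i, 0 ≤ Lip i) ∧
                ∀ (n L : ℕ), n₀ ≤ n → ℓ * M ^ (n + 1) ≤ L →
                  (∀ i, CollapseOn (obsFun r φ L i) (timeSmeared r φ L)
                      (scalingWindow (timeSmeared r φ L) (obsFun r φ L ObsIx.brancher) B θ₁ θ₂ ρ₁ ρ₂)
                      ((M : ℝ) ^ n) ((M : ℝ) ^ (n + 1)) (η i n) (K n) (Lip i)) ∧
                  (∀ D ∈ Set.Icc ((M : ℝ) ^ n) ((M : ℝ) ^ (n + 1)),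
                    ({b : ℝ | (D, b) ∈ scalingWindow (timeSmeared r φ L) (obsFun r φ L ObsIx.brancher)
                        B θ₁ θ₂ ρ₁ ρ₂}).OrdConnected))

/-- **Stub statement D′ — SMEARED BRIDGE along an admissible sequence (the jacobian-specific infrared/regularity
inputs; reshaped from the planner's `InfraredBridge`, keeping exactly what the composition consumes).**  For `r` and a
time profile `φ` there is `C_φ > 0` such that along every sequence of the crux's hypothesis block (`M`-adic shape,
`β_k → ∞`, all integer towers `N_t` convergent, `N_1 → θ > 0`, `HasLatticeMassGap r sch Δ`, `Δ > 0`):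
(d1) the time-smeared tuning observable at the sequence points converges, `N^φ_{L_k}(M^{n_k}, β_k) → Θ` with
`0 < Θ ≤ C_φ θ` (where `θ > 0` is consumed; content: `k`-equicontinuity in `u` of the scaled point-split correlator
`u ↦ a_k⁻⁸⟨P;τ_{u/a_k}P⟩_k` on `supp φ ⊂ (1, ∞)` — NOT supplied by the integer tower alone, the corner density being
time-chiral, so no Laplace/Müntz determinacy is claimed here); (d2) finite-size insensitivity AT the sequence points
(tori `S ≥ L_k`) of the time-smeared observable and of every off-diagonal canonically renormalised centred curvature
moment (the scaled, qualitative thermodynamic-limit input that (ii) as typed — per observable pair, unscaled — does not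
give).  Uniform clustering and the non-degeneracy witnesses of the old (d3)/(d4) are NOT here: they are the shared
registered legs `ClusteringLeg` / `UVRegularity` of line two-orbit.  OPEN (IR/regularity), like every line's IR leg. -/
def SmearedBridge : Prop :=
  ∀ (G : Type) [Group G] [TopologicalSpace G] [IsTopologicalGroup G] [CompactSpace G],
    IsCompactSimpleLieGroup G →
      letI : MeasurableSpace G := borel G
      haveI : BorelSpace G := ⟨rfl⟩
      ∀ (r : LatticeRep G) (φ : ℝ → ℝ), IsProfile φ →
        ∃ Cφ : ℝ, 0 < Cφ ∧
          ∀ (M : ℕ) (θ Δ : ℝ) (sch : SpeciesScheme (YMSpecies G)) (n : ℕ → ℕ),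
            2 ≤ M → 0 < θ → 0 < Δ → (∀ k, sch.a k = ((M : ℝ) ^ n k)⁻¹) →
            Tendsto sch.β atTop atTop →
            (∀ t : ℕ, 0 < t → ∃ c : ℝ, Tendsto (fun k => ((M : ℝ) ^ n k) ^ 8 *
              latticeConnectedCorr r.ρ (sch.β k) (sch.side k) r.curvature.F r.curvature.F (t * M ^ n k))
                atTop (𝓝 c)) →
            Tendsto (fun k => ((M : ℝ) ^ n k) ^ 8 *
              latticeConnectedCorr r.ρ (sch.β k) (sch.side k) r.curvature.F r.curvature.F (M ^ n k))
                atTop (𝓝 θ) →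
            HasLatticeMassGap r sch Δ →
              (∃ Θ : ℝ, 0 < Θ ∧ Θ ≤ Cφ * θ ∧
                Tendsto (fun k => timeSmeared r φ (sch.L k) ((M : ℝ) ^ n k) (sch.β k)) atTop (𝓝 Θ)) ∧
              (∀ ε > 0, ∀ᶠ k in atTop, ∀ S : ℕ, sch.L k ≤ S →
                |timeSmeared r φ S ((M : ℝ) ^ n k) (sch.β k) -
                  timeSmeared r φ (sch.L k) ((M : ℝ) ^ n k) (sch.β k)| ≤ ε) ∧
              (∀ (m : ℕ) (f : Fin m → 𝓢(E⁴, ℝ)), IsOffDiagonal (tensorOf f) →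
                ∀ ε > 0, ∀ᶠ k in atTop, ∀ S : ℕ, sch.L k ≤ S →
                  |curvMoment r (sch.β k) S (sch.a k) m f -
                    curvMoment r (sch.β k) (sch.L k) (sch.a k) m f| ≤ ε)

/-! ## §4 Registered glue of the composition (proved): the bridge to the landed two-orbit vocabulary -/

section Bridge

open Summit.QuantumFields.YangMills.Cruxes.ContinuumLimitOnTrajectory.TwoOrbitSynchronisation
  (canon curvNPoint ConvProducts canon_a' canon_β' canon_L' canon_m canon_c_curvature)

/-- **This line's centred canonical curvature moments ARE two-orbit's `curvNPoint` at the sequence points**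
(registered glue of the skeleton's composition `stubsImplyCrux`): `curvMoment r β_k L_k a_k m f = curvNPoint r sch k m f`
(`c = (a⁻¹)⁴ = (a⁴)⁻¹`, `m = plaqMean = wilsonTorusMean`, same torus, box and measure — definitional up to `inv_pow`). -/
theorem curvMoment_eq_curvNPoint :
    ∀ {G : Type} [Group G] [TopologicalSpace G] [IsTopologicalGroup G] [CompactSpace G]
      [MeasurableSpace G] [BorelSpace G] (r : LatticeRep G) (sch : SpeciesScheme (YMSpecies G)) (k m : ℕ)
      (f : Fin m → 𝓢(EuclideanSpace ℝ (Fin 4), ℝ)),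
      curvMoment r (sch.β k) (sch.L k) (sch.a k) m f = curvNPoint r sch k m f := by
  intro G _ _ _ _ _ _ r sch k m f
  unfold curvMoment curvNPoint latticeSchwinger plaqMean
  simp only [canon_a', canon_β', canon_L', canon_m, canon_c_curvature, inv_pow, wilsonTorusMean]
  rfl

/-- **Cauchy convergence of every off-diagonal centred canonical moment along the scheme gives two-orbit's
`ConvProducts`** (registered glue of the composition: completeness of `ℝ` + `curvMoment_eq_curvNPoint`). -/
theorem convProducts_of_cauchy :
    ∀ {G : Type} [Group G] [TopologicalSpace G] [IsTopologicalGroup G] [CompactSpace G]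
      [MeasurableSpace G] [BorelSpace G] (r : LatticeRep G) (sch : SpeciesScheme (YMSpecies G)),
      (∀ (m : ℕ) (f : Fin m → 𝓢(EuclideanSpace ℝ (Fin 4), ℝ)), IsOffDiagonal (tensorOf f) →
        CauchySeq fun k => curvMoment r (sch.β k) (sch.L k) (sch.a k) m f) → ConvProducts r sch := by
  intro G _ _ _ _ _ _ r sch h p _ f hf
  obtain ⟨c, hc⟩ := cauchySeq_tendsto_of_complete (h p f hf)
  exact ⟨c, hc.congr fun k => curvMoment_eq_curvNPoint r sch k p f⟩

end Bridge

end Summit.QuantumFields.YangMills.Cruxes.ContinuumLimitOnTrajectory.JacobianCollapseGronwall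

end
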